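import Mathlib.Analysis.SpecialFunctions.Pow.Real
import Mathlib.Analysis.SpecialFunctions.Log.Basic
import Mathlib.Analysis.SpecificLimits.Basic
import Mathlib.Analysis.Normed.Group.InfiniteSum
import Mathlib.Analysis.Asymptotics.Lemmas

/-!
# BalabanUVNodes ∕ N20 (NE7b) — the `hedge`-JOINT COMPANION, module 12: THE WINDOW BUDGET OF THE N19′ CORE RADIUS —
# SUMMABLE IFF BAŁABAN's «SMALL FRACTION» CONDITION, NEVER AT THE FULL KEY (crux card `window-key-core`, P1)

Cell `pub-ymgap` (HUMAN RULING D-0062 Track A; D-0149 width push), seat `pub-ymgap-dag-n20-w3` (WIDTH SEAT 3 of 3 on NODE n20 = NE7b) gen 5,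
CLAIM-1 ∕ INTENT-1 (pub-ymgap INBOX l.28897).  Filed `--kind proof --supports stmt-QuantumFields-20544 --as helper` (K3⁷
`Summit.QuantumFields.YangMills.Theses.BalabanUVNodes.SpineGivenEndpointR13SepCoPH`, skeleton of record v5 941dddb108cbaacf); COUNT-NEUTRAL.
[III] = [Balaban1988Convergent] (CMP 119), [LF-I] ∕ [LF-II] = [Balaban1989LargeFieldI∕II] (CMP 122), [King1986] = CMP 102.

WHY.  In K3⁷ v5's stub 2 `stub_expansion13H` the N19′ conjunct `KeyedCoreEdgeHolderD4 β cr rr` asks, under the crux's prefix, `∃ δ, NE7.Core … δ ∧ Summable δ`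
— ONE constant per `K`, a RADIUS `vol·δ K` uniform over ALL good classes, and only `Summable δ` is consumed.  The crux idea card `window-key-core`
(ym-nodeO idea-3 g8; `Cruxes/SpineGivenEndpointR13SepCoPH/Ideas/window-key-core.md` + `WindowKeyCoreSketch.lean`, evidence on stmt-QuantumFields-20544,
2026-08-28T04:42Z) locates the INDEX at which such a summable radius can exist: NOT the record's full (2.18)-history key (there the two-run vacuum class gap is
extensive in the old-large-field volume — the card's kernel caricature §1, and dag-n20-w1's policy wall p597932), but Bałaban's PENDING WINDOW of [LF-II] (1.80)
p.384: a large-field region born at level `j` stays in the description only for `K(Z)` steps, so at the WINDOW key the unbooked per-unit-volume gap at level `K` is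
`budget K = C · θ^K · Σ_{m ≤ j⋆(K)} (L⁴∕θ)^m` (pending blocks of age `m ≤ j⋆ K` number `≤ L^{4m}` per unit volume, each carrying a two-run increment `≤ C·θ^{K−m}` —
the card's hypothesis shape (YG), NOT proved anywhere), and [III] p.244 L20–29 «restrictions only in several previous steps, and their number is a small fraction of the
number K» becomes the card's FRACTION CONDITION `∃ κ ≥ 0, (L⁴∕θ)^κ·θ < 1 ∧ ∀ᶠ K, j⋆(K) ≤ κ·K`.  The card states two elementary real-series lemmas as `Prop`s, NOT proved
there (planners do not prove): `WindowLemma` (fraction condition ⇒ `Summable budget`) and `FullKeyLemma` (`j⋆ = id` ⇒ `¬ Summable budget`) — its item **P1 «support,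
elementary, provable now»**.  THIS FILE proves both TEXTS with their bodies spelled (a `Theorems∕` file cannot import `Cruxes∕`; no `def` is re-declared, so in the sketch's
namespace `WindowLemma` and `FullKeyLemma` follow by `exact summable_windowBudget_of_fraction` ∕ `exact not_summable_windowBudget_fullKey`), plus what a consumer of the
window road actually wants: the SHARP CONVERSE (a window that is FREQUENTLY a fraction `κ` with `(L⁴∕θ)^κ·θ ≥ 1` is not summable — the full key is `κ = 1`), the
critical fraction AS A NUMBER (`(L⁴∕θ)^κ·θ < 1 ↔ κ < κ⋆ := log θ⁻¹ ∕ log (L⁴θ⁻¹)`, `0 < κ⋆ < 1`), and the SUBLINEAR corollary (every window `j⋆ = o(K)` — in particular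
Bałaban's poly-logarithmic `j⋆(K) ≤ a + b·log (K+1)`, [LF-II] p.384 `K(Z) ≈ R_j + log_L(size Z)` — gives a summable budget with NO fraction bookkeeping at all).
* §1 [folklore] geometric-sum bookkeeping: `geom_sum_le_pow_succ_div` · `pow_le_rpow_of_natCast_le` ∕ `rpow_le_pow_of_le_natCast` · `windowBudget_nonneg` ·
  `last_le_windowBudget` (`C·θ^K·(L⁴∕θ)^{j⋆ K} ≤ budget K`) · `windowBudget_le_geometric` (`budget K ≤ C·(r∕(r−1))·θ^K·r^{j⋆ K}`, `r = L⁴∕θ`).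
* §2 ★★ `summable_windowBudget_of_fraction` (= `WindowLemma`'s text) · `windowBudget_eventually_le_exp` (exponential smallness `≤ C·(r∕(r−1))·((L⁴∕θ)^κ·θ)^K` eventually).
* §3 ★★ `not_summable_windowBudget_of_frequently_le` (sharp converse) · ★ `not_summable_windowBudget_fullKey` (= `FullKeyLemma`'s text).
* §4 ★ `rpow_mul_lt_one_iff_lt_criticalRatio` (the «small fraction» made a number) · `criticalRatio_pos` · `criticalRatio_lt_one` · ★★ `summable_windowBudget_of_isLittleO`
  (sublinear windows) · `summable_windowBudget_of_le_isLittleO` · ★ `summable_windowBudget_of_le_pow_log` (poly-log windows — the growth law of `R_k` along the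
  asymptotically free trajectory; answers CRIT-1's declared risk «`sup_j R_j(K)` not `o(K)`» by the shape that decides it) · `summable_windowBudget_of_le_log` ·
  `summable_radius_of_fraction` (the road's radius `δSF + budget`).

HONEST FRAMING.  [folklore] real-series bookkeeping over Mathlib (`geom_sum_eq`, `summable_geometric_of_lt_one`, `Summable.of_norm_bounded_eventually_nat`,
`Real.isLittleO_log_id_atTop`); proves NO estimate of the programme.  The card's physics letters — (YG) the young-gap letter, (AC) the age-cut weight, K3 the window's
definability on `Node00.SeqOfRecord` — are NOT touched, NOT asserted, NOT instantiated; `C, L, θ, j⋆` are free real∕integer letters (print LOCATES them: `L` the block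
scale, `θ` NE5's forgetting rate, `j⋆` the (1.80) window; nothing of Bałaban's is read off a datum — A6: no antecedent of this file mentions a Bałaban object, so none is
vacuous or inhabited-by-junk; A2: the hypotheses are elementary inequalities on letters).  NE7 ∕ NE7b ∕ NE7c NOT PRINTED for `d = 4`, NOT proved; N19 ∕ N20 NOT
discharged; K3⁷ NOT closed; counts unmoved (typed 28∕28 · discharged 5∕27); no count claim.  One finite `𝕋⁴_{L^K}` programme at fixed `ε = L^{−K}`, Bałaban AS
PRINTED; the YM mass gap (Clay) is NOT proved by any of this — R4 closes the conditional finite-𝕋⁴ rung `BalabanLadder.UV` only; NOT ℝ⁴, NOT continuum, NOT OS.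
No `def`, no `instance`, no `notation`, no `sorry`, no private decls.  Sources (location only): [III] p.244 L20–29, (1.1) p.244; [LF-II] (1.79)–(1.83) pp.384–385;
[LF-I] p.175; [King1986] (3.10)–(3.13) pp.656–657 (the full-history index in `d ≤ 3`).
-/

noncomputable section

open Finset Filter Asymptotics
open scoped BigOperators Topology

namespace Summit.QuantumFields.YangMills.BalabanUVNodes.N20WindowKeyBudget

/-! ## §1 Geometric-sum bookkeeping for the window budget `C · θ^K · Σ_{m ≤ j⋆ K} (L⁴∕θ)^m` -/

/-- A finite geometric sum with ratio `r > 1` is at most its next term over `r − 1`: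
`Σ_{m < j+1} r^m = (r^{j+1} − 1)∕(r − 1) ≤ r^{j+1}∕(r − 1)`. [folklore] -/
theorem geom_sum_le_pow_succ_div {r : ℝ} (hr : 1 < r) (j : ℕ) :
    ∑ m ∈ range (j + 1), r ^ m ≤ r ^ (j + 1) / (r - 1) := by
  rw [geom_sum_eq hr.ne' (j + 1)]
  exact div_le_div_of_nonneg_right (by linarith) (sub_pos.mpr hr).le

/-- Monotonicity of `r ^ ·` across the `ℕ`∕`ℝ` exponent border, base `r ≥ 1`: `j ≤ x ⇒ r^j ≤ r^x`. [folklore] -/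
theorem pow_le_rpow_of_natCast_le {r : ℝ} (hr : 1 ≤ r) {j : ℕ} {x : ℝ} (h : (j : ℝ) ≤ x) : r ^ j ≤ r ^ x := by
  rw [← Real.rpow_natCast]
  exact Real.rpow_le_rpow_of_exponent_le hr h

/-- Monotonicity of `r ^ ·` across the `ℝ`∕`ℕ` exponent border, base `r ≥ 1`: `x ≤ j ⇒ r^x ≤ r^j`. [folklore] -/
theorem rpow_le_pow_of_le_natCast {r : ℝ} (hr : 1 ≤ r) {j : ℕ} {x : ℝ} (h : x ≤ (j : ℝ)) : r ^ x ≤ r ^ j := by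
  rw [← Real.rpow_natCast]
  exact Real.rpow_le_rpow_of_exponent_le hr h

/-- `(r^κ)^K = r^{κ·K}` read as a natural power of the real power (base `r ≥ 0`). [folklore] -/
theorem rpow_mul_natCast_eq_pow {r : ℝ} (hr : 0 ≤ r) (κ : ℝ) (K : ℕ) : r ^ (κ * K) = (r ^ κ) ^ K :=
  Real.rpow_mul_natCast hr κ K

/-- The window ratio `r = L⁴∕θ` exceeds `1` (block scale `L > 1`, forgetting rate `0 < θ < 1`). [folklore] -/
theorem one_lt_ratio {L θ : ℝ} (hL : 1 < L) (hθ : 0 < θ) (hθ1 : θ < 1) : 1 < L ^ 4 / θ := by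
  have hL4 : 1 < L ^ 4 := one_lt_pow₀ hL (by norm_num)
  rw [lt_div_iff₀ hθ]
  linarith

/-- The window budget is non-negative (`C ≥ 0`, `θ > 0`; the ratio `L⁴∕θ ≥ 0` for every real `L`). [folklore] -/
theorem windowBudget_nonneg {C L θ : ℝ} (hC : 0 ≤ C) (hθ : 0 < θ) (jstar : ℕ → ℕ) (K : ℕ) :
    0 ≤ C * θ ^ K * ∑ m ∈ range (jstar K + 1), (L ^ 4 / θ) ^ m := by
  have hr : 0 ≤ L ^ 4 / θ := by positivity
  have hs : 0 ≤ ∑ m ∈ range (jstar K + 1), (L ^ 4 / θ) ^ m := sum_nonneg fun m _ => pow_nonneg hr m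
  positivity

/-- LOWER END: the budget dominates its LAST term `C · θ^K · (L⁴∕θ)^{j⋆ K}` (`= C · L^{4 j⋆} · θ^{K − j⋆}` — the oldest pending age alone). [folklore] -/
theorem last_le_windowBudget {C L θ : ℝ} (hC : 0 ≤ C) (hθ : 0 < θ) (jstar : ℕ → ℕ) (K : ℕ) :
    C * θ ^ K * (L ^ 4 / θ) ^ jstar K ≤ C * θ ^ K * ∑ m ∈ range (jstar K + 1), (L ^ 4 / θ) ^ m := by
  have hr : 0 ≤ L ^ 4 / θ := by positivity
  have hlast : (L ^ 4 / θ) ^ jstar K ≤ ∑ m ∈ range (jstar K + 1), (L ^ 4 / θ) ^ m :=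
    single_le_sum (f := fun m => (L ^ 4 / θ) ^ m) (fun m _ => pow_nonneg hr m) (self_mem_range_succ (jstar K))
  have hCθ : 0 ≤ C * θ ^ K := by positivity
  exact mul_le_mul_of_nonneg_left hlast hCθ

/-- UPPER END: the budget is at most `C · (r∕(r−1)) · θ^K · r^{j⋆ K}` with `r = L⁴∕θ > 1` — the last term times the geometric constant `r∕(r−1)`. [folklore] -/
theorem windowBudget_le_geometric {C L θ : ℝ} (hC : 0 ≤ C) (hθ : 0 < θ) (hr : 1 < L ^ 4 / θ) (jstar : ℕ → ℕ) (K : ℕ) :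
    C * θ ^ K * ∑ m ∈ range (jstar K + 1), (L ^ 4 / θ) ^ m
      ≤ C * ((L ^ 4 / θ) / (L ^ 4 / θ - 1)) * (θ ^ K * (L ^ 4 / θ) ^ jstar K) := by
  set r : ℝ := L ^ 4 / θ with hr_def
  have hr0 : 0 < r := lt_trans one_pos hr
  have hr1 : 0 < r - 1 := sub_pos.mpr hr
  have hsum : ∑ m ∈ range (jstar K + 1), r ^ m ≤ r ^ (jstar K + 1) / (r - 1) := geom_sum_le_pow_succ_div hr (jstar K)
  have hCθ : 0 ≤ C * θ ^ K := by positivity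
  calc C * θ ^ K * ∑ m ∈ range (jstar K + 1), r ^ m
      ≤ C * θ ^ K * (r ^ (jstar K + 1) / (r - 1)) := mul_le_mul_of_nonneg_left hsum hCθ
    _ = C * (r / (r - 1)) * (θ ^ K * r ^ jstar K) := by
        rw [pow_succ]
        field_simp

/-! ## §2 The card's `WindowLemma`: under the FRACTION CONDITION the budget is summable (indeed exponentially small) -/

/-- Under a fraction `κ ≥ 0` of the window, eventually `budget K ≤ C·(r∕(r−1))·((L⁴∕θ)^κ · θ)^K`: exponential smallness in `K` as soon as `(L⁴∕θ)^κ·θ < 1`. [folklore] -/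
theorem windowBudget_eventually_le_exp {C L θ κ : ℝ} (hC : 0 ≤ C) (hL : 1 < L) (hθ : 0 < θ) (hθ1 : θ < 1) (jstar : ℕ → ℕ)
    (hj : ∀ᶠ K : ℕ in atTop, (jstar K : ℝ) ≤ κ * K) :
    ∀ᶠ K : ℕ in atTop, C * θ ^ K * ∑ m ∈ range (jstar K + 1), (L ^ 4 / θ) ^ m
      ≤ C * ((L ^ 4 / θ) / (L ^ 4 / θ - 1)) * ((L ^ 4 / θ) ^ κ * θ) ^ K := by
  have hr : 1 < L ^ 4 / θ := one_lt_ratio hL hθ hθ1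
  have hr0 : 0 ≤ L ^ 4 / θ := (lt_trans one_pos hr).le
  filter_upwards [hj] with K hK
  have hpow : (L ^ 4 / θ) ^ jstar K ≤ ((L ^ 4 / θ) ^ κ) ^ K := by
    rw [← rpow_mul_natCast_eq_pow hr0 κ K]
    exact pow_le_rpow_of_natCast_le hr.le hK
  have hgeo := windowBudget_le_geometric hC hθ hr jstar K
  have hconst : 0 ≤ C * ((L ^ 4 / θ) / (L ^ 4 / θ - 1)) := by
    have : 0 < L ^ 4 / θ - 1 := sub_pos.mpr hr
    positivity
  calc C * θ ^ K * ∑ m ∈ range (jstar K + 1), (L ^ 4 / θ) ^ m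
      ≤ C * ((L ^ 4 / θ) / (L ^ 4 / θ - 1)) * (θ ^ K * (L ^ 4 / θ) ^ jstar K) := hgeo
    _ ≤ C * ((L ^ 4 / θ) / (L ^ 4 / θ - 1)) * (θ ^ K * ((L ^ 4 / θ) ^ κ) ^ K) := by
        gcongr
    _ = C * ((L ^ 4 / θ) / (L ^ 4 / θ - 1)) * ((L ^ 4 / θ) ^ κ * θ) ^ K := by
        rw [mul_pow, mul_comm (θ ^ K)]

/-- **★★ THE WINDOW LEMMA** (crux card `window-key-core` P1, `WindowKeyCoreSketch.lean` §2 `WindowLemma` — its TEXT, with `windowBudget` and `FractionCondition`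
unfolded): for `C ≥ 0`, block scale `L > 1`, forgetting rate `0 < θ < 1` and a window `j⋆` that is EVENTUALLY A SMALL FRACTION of `K` — `∃ κ ≥ 0` with
`(L⁴∕θ)^κ · θ < 1` and `j⋆ K ≤ κ·K` for all large `K` ([III] p.244 «their number is a small fraction of the number K», made quantitative) — the per-unit-volume
window budget `K ↦ C · θ^K · Σ_{m ≤ j⋆ K} (L⁴∕θ)^m` of the N19′ core radius is SUMMABLE.  In the sketch's namespace: `theorem windowLemma : WindowLemma :=
fun C L θ jstar hC hL hθ hθ1 hfrac => summable_windowBudget_of_fraction C L θ jstar hC hL hθ hθ1 hfrac`.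
[cite: Balaban1988Convergent, p.244 L20–29; Balaban1989LargeFieldII, (1.80) p.384 (location of the letters only)] [folklore] -/
theorem summable_windowBudget_of_fraction (C L θ : ℝ) (jstar : ℕ → ℕ) (hC : 0 ≤ C) (hL : 1 < L) (hθ : 0 < θ) (hθ1 : θ < 1)
    (hfrac : ∃ κ : ℝ, 0 ≤ κ ∧ (L ^ 4 / θ) ^ κ * θ < 1 ∧ ∀ᶠ K : ℕ in atTop, (jstar K : ℝ) ≤ κ * K) :
    Summable (fun K : ℕ => C * θ ^ K * ∑ m ∈ range (jstar K + 1), (L ^ 4 / θ) ^ m) := by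
  obtain ⟨κ, -, hq, hj⟩ := hfrac
  have hr : 1 < L ^ 4 / θ := one_lt_ratio hL hθ hθ1
  have hq0 : 0 ≤ (L ^ 4 / θ) ^ κ * θ := by
    have : 0 ≤ (L ^ 4 / θ) ^ κ := Real.rpow_nonneg (lt_trans one_pos hr).le κ
    positivity
  have hgeom : Summable fun K : ℕ => C * ((L ^ 4 / θ) / (L ^ 4 / θ - 1)) * ((L ^ 4 / θ) ^ κ * θ) ^ K :=
    (summable_geometric_of_lt_one hq0 hq).mul_left _
  refine Summable.of_norm_bounded_eventually_nat hgeom ?_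
  filter_upwards [windowBudget_eventually_le_exp hC hL hθ hθ1 jstar hj] with K hK
  rw [Real.norm_of_nonneg (windowBudget_nonneg hC hθ jstar K)]
  exact hK

/-! ## §3 The card's `FullKeyLemma` and its sharp form: a window that is NOT a small fraction is not summable -/

/-- **★★ SHARP CONVERSE**: if for some `κ` with `(L⁴∕θ)^κ · θ ≥ 1` the window is FREQUENTLY at least the fraction `κ` of `K` (`κ·K ≤ j⋆ K` for infinitely many `K`),
then `budget K ≥ C · ((L⁴∕θ)^κ·θ)^K ≥ C > 0` along that subsequence, so the budget does not tend to zero and is NOT summable.  With §2: the budget's summability is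
decided by the window's fraction against the critical ratio `κ⋆ = log θ⁻¹ ∕ log (L⁴∕θ)` (§4) — below it eventually: summable; at or above it frequently: not. [folklore] -/
theorem not_summable_windowBudget_of_frequently_le {C L θ κ : ℝ} (hC : 0 < C) (hθ : 0 < θ) (hr : 1 ≤ L ^ 4 / θ)
    (hκ : 1 ≤ (L ^ 4 / θ) ^ κ * θ) (jstar : ℕ → ℕ) (hj : ∃ᶠ K : ℕ in atTop, κ * K ≤ (jstar K : ℝ)) :
    ¬ Summable (fun K : ℕ => C * θ ^ K * ∑ m ∈ range (jstar K + 1), (L ^ 4 / θ) ^ m) := by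
  intro hs
  have h0 := hs.tendsto_atTop_zero
  have hev : ∀ᶠ K : ℕ in atTop, C * θ ^ K * ∑ m ∈ range (jstar K + 1), (L ^ 4 / θ) ^ m < C :=
    h0.eventually (gt_mem_nhds hC)
  obtain ⟨K, hK, hlt⟩ := (hj.and_eventually hev).exists
  have hr0 : 0 ≤ L ^ 4 / θ := le_trans zero_le_one hr
  -- along the subsequence the last term alone is `≥ C · ((L⁴∕θ)^κ · θ)^K ≥ C`
  have hpow : ((L ^ 4 / θ) ^ κ) ^ K ≤ (L ^ 4 / θ) ^ jstar K := by
    rw [← rpow_mul_natCast_eq_pow hr0 κ K]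
    exact rpow_le_pow_of_le_natCast hr hK
  have hge : C ≤ C * θ ^ K * ∑ m ∈ range (jstar K + 1), (L ^ 4 / θ) ^ m := by
    calc C = C * 1 ^ K := by rw [one_pow, mul_one]
      _ ≤ C * ((L ^ 4 / θ) ^ κ * θ) ^ K := by gcongr
      _ = C * θ ^ K * ((L ^ 4 / θ) ^ κ) ^ K := by rw [mul_pow]; ring
      _ ≤ C * θ ^ K * (L ^ 4 / θ) ^ jstar K := by gcongr
      _ ≤ C * θ ^ K * ∑ m ∈ range (jstar K + 1), (L ^ 4 / θ) ^ m := last_le_windowBudget hC.le hθ jstar K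
  exact absurd hlt (not_lt.mpr hge)

/-- **★ THE FULL-KEY LEMMA** (crux card `window-key-core` P1, `WindowKeyCoreSketch.lean` §2 `FullKeyLemma` — its TEXT with `windowBudget C L θ fun K => K` unfolded):
with NO window (`j⋆ K = K`: the record's full (2.18)-history key, [King1986]'s `d ≤ 3` index) the budget dominates `C · L^{4K} ≥ C > 0` and is NOT summable — the
per-unit-volume form of the card's extensive-gap caricature §1.  (The fraction here is `κ = 1`, and `(L⁴∕θ)¹ · θ = L⁴ ≥ 1`.)  In the sketch's namespace:
`theorem fullKeyLemma : FullKeyLemma := fun C L θ hC hL hθ hθ1 => not_summable_windowBudget_fullKey C L θ hC hL hθ hθ1`.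
[cite: King1986, (3.10)–(3.13) pp.656–657; Balaban1989LargeFieldI, p.175 (location only)] [folklore] -/
theorem not_summable_windowBudget_fullKey (C L θ : ℝ) (hC : 0 < C) (hL : 1 < L) (hθ : 0 < θ) (hθ1 : θ < 1) :
    ¬ Summable (fun K : ℕ => C * θ ^ K * ∑ m ∈ range (K + 1), (L ^ 4 / θ) ^ m) := by
  have hr : 1 < L ^ 4 / θ := one_lt_ratio hL hθ hθ1
  have hκ : 1 ≤ (L ^ 4 / θ) ^ (1 : ℝ) * θ := by
    rw [Real.rpow_one, div_mul_cancel₀ _ hθ.ne']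
    exact (one_lt_pow₀ hL (by norm_num)).le
  have hj : ∃ᶠ K : ℕ in atTop, (1 : ℝ) * K ≤ ((fun K : ℕ => K) K : ℝ) :=
    Frequently.of_forall fun K => by simp
  exact not_summable_windowBudget_of_frequently_le hC hθ hr.le hκ (fun K => K) hj

/-! ## §4 The «small fraction» as a number, sublinear ∕ poly-logarithmic windows, and the road's radius -/

/-- **★ THE CRITICAL FRACTION**: for `L > 1`, `0 < θ < 1` and any real `κ`, `(L⁴∕θ)^κ · θ < 1 ↔ κ < κ⋆` with `κ⋆ := log θ⁻¹ ∕ log (L⁴∕θ)` — the fraction of `K`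
below which Bałaban's pending window leaves a summable N19′ radius ([III] p.244's «small fraction», quantified). [folklore] -/
theorem rpow_mul_lt_one_iff_lt_criticalRatio {L θ : ℝ} (hL : 1 < L) (hθ : 0 < θ) (hθ1 : θ < 1) (κ : ℝ) :
    (L ^ 4 / θ) ^ κ * θ < 1 ↔ κ < Real.log θ⁻¹ / Real.log (L ^ 4 / θ) := by
  have hr : 1 < L ^ 4 / θ := one_lt_ratio hL hθ hθ1
  have hr0 : 0 < L ^ 4 / θ := lt_trans one_pos hr
  have hlog : 0 < Real.log (L ^ 4 / θ) := Real.log_pos hr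
  have hpos : 0 < (L ^ 4 / θ) ^ κ * θ := mul_pos (Real.rpow_pos_of_pos hr0 κ) hθ
  rw [← Real.log_neg_iff hpos, Real.log_mul (Real.rpow_pos_of_pos hr0 κ).ne' hθ.ne', Real.log_rpow hr0, Real.log_inv,
    lt_div_iff₀ hlog]
  constructor <;> intro h <;> linarith

/-- The critical fraction is POSITIVE (`θ < 1`): SOME positive fraction of `K` is always allowed. [folklore] -/
theorem criticalRatio_pos {L θ : ℝ} (hL : 1 < L) (hθ : 0 < θ) (hθ1 : θ < 1) : 0 < Real.log θ⁻¹ / Real.log (L ^ 4 / θ) :=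
  div_pos (Real.log_pos ((one_lt_inv₀ hθ).mpr hθ1)) (Real.log_pos (one_lt_ratio hL hθ hθ1))

/-- The critical fraction is `< 1` (`L > 1`): the FULL key (`κ = 1`) is never inside — §3's `not_summable_windowBudget_fullKey` read off the number. [folklore] -/
theorem criticalRatio_lt_one {L θ : ℝ} (hL : 1 < L) (hθ : 0 < θ) (hθ1 : θ < 1) : Real.log θ⁻¹ / Real.log (L ^ 4 / θ) < 1 := by
  have hr : 1 < L ^ 4 / θ := one_lt_ratio hL hθ hθ1
  have hlog : 0 < Real.log (L ^ 4 / θ) := Real.log_pos hr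
  have hL4 : 1 < L ^ 4 := one_lt_pow₀ hL (by norm_num)
  rw [div_lt_one hlog, Real.log_div (by positivity) hθ.ne', Real.log_inv]
  linarith [Real.log_pos hL4]

/-- **★★ SUBLINEAR WINDOWS ARE ALWAYS INSIDE**: if the window is `o(K)` — `(K ↦ j⋆ K) =o[atTop] (K ↦ K)` over `ℝ` — then for EVERY `C ≥ 0`, `L > 1`, `0 < θ < 1` the
budget is summable, with no fraction bookkeeping: pick any `0 < κ < κ⋆` (`criticalRatio_pos`) and the little-o bound supplies `j⋆ K ≤ κ·K` eventually. [folklore] -/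
theorem summable_windowBudget_of_isLittleO (C L θ : ℝ) (jstar : ℕ → ℕ) (hC : 0 ≤ C) (hL : 1 < L) (hθ : 0 < θ) (hθ1 : θ < 1)
    (ho : (fun K : ℕ => (jstar K : ℝ)) =o[atTop] (fun K : ℕ => (K : ℝ))) :
    Summable (fun K : ℕ => C * θ ^ K * ∑ m ∈ range (jstar K + 1), (L ^ 4 / θ) ^ m) := by
  set κ : ℝ := (Real.log θ⁻¹ / Real.log (L ^ 4 / θ)) / 2 with hκ_def
  have hκs : 0 < Real.log θ⁻¹ / Real.log (L ^ 4 / θ) := criticalRatio_pos hL hθ hθ1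
  have hκ0 : 0 < κ := by positivity
  have hκlt : κ < Real.log θ⁻¹ / Real.log (L ^ 4 / θ) := by rw [hκ_def]; linarith
  refine summable_windowBudget_of_fraction C L θ jstar hC hL hθ hθ1 ⟨κ, hκ0.le, ?_, ?_⟩
  · exact (rpow_mul_lt_one_iff_lt_criticalRatio hL hθ hθ1 κ).mpr hκlt
  · filter_upwards [ho.def hκ0] with K hK
    simpa only [Real.norm_natCast] using hK

/-- A window EVENTUALLY MAJORISED by any real sequence `φ = o(K)` is itself `o(K)`, hence gives a summable budget (`C ≥ 0`, `L > 1`, `0 < θ < 1`). [folklore] -/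
theorem summable_windowBudget_of_le_isLittleO (C L θ : ℝ) (jstar : ℕ → ℕ) (φ : ℕ → ℝ) (hC : 0 ≤ C) (hL : 1 < L) (hθ : 0 < θ) (hθ1 : θ < 1)
    (hφ : φ =o[atTop] (fun K : ℕ => (K : ℝ))) (hj : ∀ᶠ K : ℕ in atTop, (jstar K : ℝ) ≤ φ K) :
    Summable (fun K : ℕ => C * θ ^ K * ∑ m ∈ range (jstar K + 1), (L ^ 4 / θ) ^ m) := by
  refine summable_windowBudget_of_isLittleO C L θ jstar hC hL hθ hθ1 (IsLittleO.of_isBigOWith fun c hc => ?_)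
  refine IsBigOWith.of_bound ?_
  filter_upwards [hj, hφ.def hc] with K hK hK'
  rw [Real.norm_natCast]
  exact hK.trans ((Real.le_norm_self _).trans hK')

/-- **POLY-LOGARITHMIC WINDOWS ARE ALWAYS INSIDE** (Bałaban's own: [LF-II] p.384, a region is pending for `K(Z) ≈ R_j + log_L (size Z)` steps; the card's
`j⋆(K) = sup_j R_j + κ₁ log K`; along the asymptotically free trajectory `R_k`, tied to `p₀(g_k) = A₀ (log g_k⁻²)^{p₀}` by [III] (1.1)–(1.8) p.244–246, grows like a
POWER OF `log k` — CRIT-1's declared risk «`sup_j R_j(K)` not `o(K)` ⇒ `WindowLemma` void» is therefore decided by a growth law of this shape): a window bounded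
by `a + b · (log (K + 1))^p` for some `p : ℕ` is `o(K)` (`Real.isLittleO_pow_log_id_atTop`), hence gives a summable budget for every `C ≥ 0`, `L > 1`, `0 < θ < 1` —
NO fraction bookkeeping. [cite: Balaban1989LargeFieldII, (1.80) p.384; Balaban1988Convergent, (1.1) p.244 (location of the letters only)] [folklore] -/
theorem summable_windowBudget_of_le_pow_log (C L θ a b : ℝ) (p : ℕ) (jstar : ℕ → ℕ) (hC : 0 ≤ C) (hL : 1 < L) (hθ : 0 < θ) (hθ1 : θ < 1)
    (hj : ∀ᶠ K : ℕ in atTop, (jstar K : ℝ) ≤ a + b * Real.log ((K : ℝ) + 1) ^ p) :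
    Summable (fun K : ℕ => C * θ ^ K * ∑ m ∈ range (jstar K + 1), (L ^ 4 / θ) ^ m) := by
  refine summable_windowBudget_of_le_isLittleO C L θ jstar (fun K => a + b * Real.log ((K : ℝ) + 1) ^ p) hC hL hθ hθ1 ?_ hj
  -- `a + b·(log (x+1))^p = o(x)` over `ℝ`, from `(log x)^p = o(x)` and `const = o(x)`, then restricted to `ℕ`
  have hlog : (fun x : ℝ => Real.log (x + 1) ^ p) =o[atTop] (fun x : ℝ => x) := by
    have h1 : (fun x : ℝ => Real.log (x + 1) ^ p) =o[atTop] (fun x : ℝ => x + 1) :=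
      Real.isLittleO_pow_log_id_atTop.comp_tendsto (tendsto_atTop_add_const_right atTop 1 tendsto_id)
    have h2 : (fun x : ℝ => x + 1) =O[atTop] (fun x : ℝ => x) :=
      (isBigO_refl (fun x : ℝ => x) atTop).add (isLittleO_const_id_atTop (1 : ℝ)).isBigO
    exact h1.trans_isBigO h2
  have hmaj : (fun x : ℝ => a + b * Real.log (x + 1) ^ p) =o[atTop] (fun x : ℝ => x) :=
    (isLittleO_const_id_atTop a).add (hlog.const_mul_left b)
  exact hmaj.natCast_atTop

/-- **LOGARITHMIC WINDOWS** (the case `p = 1`: `j⋆ K ≤ a + b · log (K + 1)`, e.g. a bounded `sup_j R_j` plus the `κ₁ log K` margin). [folklore] -/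
theorem summable_windowBudget_of_le_log (C L θ a b : ℝ) (jstar : ℕ → ℕ) (hC : 0 ≤ C) (hL : 1 < L) (hθ : 0 < θ) (hθ1 : θ < 1)
    (hj : ∀ᶠ K : ℕ in atTop, (jstar K : ℝ) ≤ a + b * Real.log ((K : ℝ) + 1)) :
    Summable (fun K : ℕ => C * θ ^ K * ∑ m ∈ range (jstar K + 1), (L ^ 4 / θ) ^ m) :=
  summable_windowBudget_of_le_pow_log C L θ a b 1 jstar hC hL hθ hθ1 (by simpa only [pow_one] using hj)

/-- **THE ROAD's RADIUS** (the card's `WindowRoadOutput`, first two conjuncts): a Core radius `δSF + budget` — node U6's geometric small-field channel plus the window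
budget — is summable under the fraction condition as soon as the small-field channel is.  (Only `Summable δ` is consumed by K3⁷ v5's `KeyedCoreEdgeHolderD4`.) [folklore] -/
theorem summable_radius_of_fraction (C L θ : ℝ) (jstar : ℕ → ℕ) (δSF : ℕ → ℝ) (hSF : Summable δSF) (hC : 0 ≤ C) (hL : 1 < L) (hθ : 0 < θ)
    (hθ1 : θ < 1) (hfrac : ∃ κ : ℝ, 0 ≤ κ ∧ (L ^ 4 / θ) ^ κ * θ < 1 ∧ ∀ᶠ K : ℕ in atTop, (jstar K : ℝ) ≤ κ * K) :
    Summable (fun K : ℕ => δSF K + C * θ ^ K * ∑ m ∈ range (jstar K + 1), (L ^ 4 / θ) ^ m) :=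
  hSF.add (summable_windowBudget_of_fraction C L θ jstar hC hL hθ hθ1 hfrac)

end Summit.QuantumFields.YangMills.BalabanUVNodes.N20WindowKeyBudget

end
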